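import Mathlib
import Summits.Ventures.HodgeRepro.Tier4.Line4.CentreScalar
import Summits.Ventures.HodgeRepro.Tier4.Line4.CharacterPairFull

/-!
# Tier4/Line4/CentreWeights — the weights of a CENTRAL element are the same on both lines and both tori, and the
clause `hagree` of the wall's pair from the INTEGER relation `eP w + eM w = eP′ w + eM′ w` under «general position»
(C-L4-B-EXTEND, part 9b = V-B7 of the (B) row census)

Blind re-derivation cell `pub-hodge-repro`, Tier 4 «prove the step» (README §9–§10), seat t4-x2 (reserve
wall-breaker, gen 6; GO S16576).  Tree path `lean/Summits/Ventures/HodgeRepro/Tier4/Line4/CentreWeights.lean`.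
Imports: Mathlib + `Tier4/Line4/CentreScalar` (`exists_scalar_of_mem_centre`) + `Tier4/Line4/CharacterPairFull` (the
chain parts 1–8; RowWeights' `weightAt_of_mat`, `blockWeight`; RowTorus' `adMat_blockDiag4`, `blockOf`; typer-2's
`mat_conjTo`, `weightAt'_eq_weightAt_conjTo`).  No definition, no instance, no printed theorem proved.

* `weightAt_eq_blockWeight_of_mat_scalar` — on a row plane (any `ofLinesRow`-shaped `Ω = blockDiag4 ω ω`), an element
  with matrix `x • 1 + y • adMat Ω` has weight `blockWeight x y = φ(x) + φ(y) ω_w` on BOTH lines;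
* `weightAt'_eq_blockWeight_of_mat_scalar_seesaw` — the same for the transported weights on the seesaw plane
  (`g′ (x • 1 + y • Ω) g = x • 1 + y • Ω` as `g Ω = Ω g`);
* **`hagree_of_sum_of_gen`** — `hagree` (the clause of `exists_wall_character'_pair_seesaw_of_agree` /
  `exists_wall_character_pair_seesaw_of_agree`) from the INTEGER relation `hsum : ∀ w, eP w + eM w = eP′ w + eM′ w`
  and «general position» `hgen : T_∞ ∩ T′_∞ ⊆ Z(𝔸)` (the two tori meet only in the centre at infinity): a central
  `t` is an `E′`-scalar (`exists_scalar_of_mem_centre`), so every weight of `t` is the one number `u_w`, and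
  `∏ u_w^{−eP w − eM w} = ∏ u_w^{−eP′ w − eM′ w}`;
* **`exists_wall_character_pair_seesaw_of_sum`** — the (B) row with `hagree` discharged: the pair from the integers
  modulo the print (twice), p723452's `hcl`/`hbot`, `hsum` and `hgen`.
`hgen` is NOT a tree theorem (the «general position» of the two tori: the tori of the line's faces meet only in the
centre at every real place is a property of the face's data; census).  Nothing here says anything about the status of
the Hodge conjecture for CM abelian varieties, which is NOT proved; HC_CM is NOT proved by anyone in this repository.
-/

set_option autoImplicit false

noncomputable section

namespace Summit.Ventures.HodgeRepro.Tier4.Line4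

open NumberField Matrix Summit.Ventures.HodgeRepro.Tier4.Common Summit.Ventures.HodgeRepro.Tier4.Line1
  Summit.Ventures.HodgeRepro.Tier4.Lit

section ScalarWeights

variable {k : Type} [Field k] [NumberField k] (q : QuadData k) (w : InfinitePlace k)

/-- `x • 1 + y • adMat (blockDiag4 ω ω)` is the block-diagonal matrix with both blocks `blockOf t n x y`. -/
theorem smul_one_add_smul_adMat_blockDiag4_omega (x y : Ad k) :
    x • (1 : M4 k) + y • adMat k (blockDiag4 (omegaMat q) (omegaMat q)) =
      blockDiag4R (blockOf (algebraMap k (Ad k) q.t) (algebraMap k (Ad k) q.n) x y)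
        (blockOf (algebraMap k (Ad k) q.t) (algebraMap k (Ad k) q.n) x y) := by
  rw [adMat_blockDiag4, omegaMat_map, ← blockDiag4R_one]
  simp only [blockOf, blockDiag4R, re4R]
  rw [← map_smul, ← map_smul, ← map_add]
  congr 1
  rw [Matrix.fromBlocks_smul, Matrix.fromBlocks_smul, Matrix.fromBlocks_add, smul_zero, smul_zero, zero_add]

/-- **The weights of an `E′`-scalar**: on a plane with `Ω = blockDiag4 ω ω` (the row planes and their transports),
an element with matrix `x • 1 + y • adMat Ω` has the same weight `blockWeight x y` on both lines. -/
theorem weightAt_eq_blockWeight_of_mat_scalar (W : PlaneData k) (hΩ : W.Ω = blockDiag4 (omegaMat q) (omegaMat q))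
    (κ : GA W) (x y : Ad k) (h : GA.mat W κ = x • (1 : M4 k) + y • adMat k W.Ω) (j : Fin 2) :
    weightAt W q w j κ = blockWeight q w x y := by
  have hm : GA.mat W κ = blockDiag4R (blockOf (algebraMap k (Ad k) q.t) (algebraMap k (Ad k) q.n) x y)
      (blockOf (algebraMap k (Ad k) q.t) (algebraMap k (Ad k) q.n) x y) := by
    rw [h, hΩ]
    exact smul_one_add_smul_adMat_blockDiag4_omega q x y
  rw [weightAt_of_mat q w W κ x y x y hm]
  split_ifs <;> rfl

end ScalarWeights

section Seesaw

variable {k : Type} [Field k] [NumberField k] (q : QuadData k) (a : Fin 4 → k)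
  (g g' : Matrix (Fin 4) (Fin 4) k) (hgg' : g * g' = 1) (hg'g : g' * g = 1)
  (hgΩ : g * (PlaneData.mixedRow q (a 0) (a 2)).Ω = (PlaneData.mixedRow q (a 0) (a 2)).Ω * g)
  (lam : k) (hlam : lam ≠ 0)
  (hiso : g * (PlaneData.mixedRow q (a 1) (a 3)).B * gᵀ = lam • (PlaneData.mixedRow q (a 0) (a 2)).B)

omit [NumberField k] in
/-- The `Ω` of the seesaw plane is `blockDiag4 ω ω`. -/
theorem seesaw_Omega_eq :
    ((PlaneData.mixedRow q (a 0) (a 2)).withTransportedTorus g g' hgg' hg'g hgΩ).Ω =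
      blockDiag4 (omegaMat q) (omegaMat q) := rfl

omit [NumberField k] in
include hg'g hgΩ in
/-- `g′ Ω g = Ω` for the transport. -/
theorem transpose_conj_Omega_eq : g' * (PlaneData.mixedRow q (a 0) (a 2)).Ω * g = (PlaneData.mixedRow q (a 0) (a 2)).Ω := by
  calc g' * (PlaneData.mixedRow q (a 0) (a 2)).Ω * g = g' * ((PlaneData.mixedRow q (a 0) (a 2)).Ω * g) := by
        rw [Matrix.mul_assoc]
    _ = g' * (g * (PlaneData.mixedRow q (a 0) (a 2)).Ω) := by rw [hgΩ]
    _ = (g' * g) * (PlaneData.mixedRow q (a 0) (a 2)).Ω := by rw [Matrix.mul_assoc]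
    _ = (PlaneData.mixedRow q (a 0) (a 2)).Ω := by rw [hg'g, Matrix.one_mul]

include lam hiso in
/-- **The transported weights of an `E′`-scalar** on the seesaw plane are `blockWeight x y` on both lines. -/
theorem weightAt'_eq_blockWeight_of_mat_scalar_seesaw (w : InfinitePlace k)
    (κ : GA ((PlaneData.mixedRow q (a 0) (a 2)).withTransportedTorus g g' hgg' hg'g hgΩ)) (x y : Ad k)
    (h : GA.mat _ κ = x • (1 : M4 k) +
      y • adMat k ((PlaneData.mixedRow q (a 0) (a 2)).withTransportedTorus g g' hgg' hg'g hgΩ).Ω) (j : Fin 2) :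
    weightAt' ((PlaneData.mixedRow q (a 0) (a 2)).withTransportedTorus g g' hgg' hg'g hgΩ) q w g g' j κ =
      blockWeight q w x y := by
  rw [weightAt'_eq_weightAt_conjTo q a g g' hgg' hg'g hgΩ lam hiso]
  refine weightAt_eq_blockWeight_of_mat_scalar q w (PlaneData.ofLinesRow q (a 1) (a 3) (-1)) rfl _ x y ?_ j
  rw [mat_conjTo, h, seesaw_Omega_eq]
  have hA : adMat k g' * adMat k g = 1 := Line4.adMat_mul_adMat_eq_one g' g hg'g
  have hΩ' : adMat k g' * adMat k (blockDiag4 (omegaMat q) (omegaMat q)) * adMat k g =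
      adMat k (blockDiag4 (omegaMat q) (omegaMat q)) := by
    rw [← adMat_mul, ← adMat_mul]
    exact congrArg (adMat k) (transpose_conj_Omega_eq q a g g' hg'g hgΩ)
  show adMat k g' * (x • (1 : M4 k) + y • adMat k (blockDiag4 (omegaMat q) (omegaMat q))) * adMat k g =
    x • (1 : M4 k) + y • adMat k (blockDiag4 (omegaMat q) (omegaMat q))
  rw [Matrix.mul_add, Matrix.add_mul, Matrix.mul_smul, Matrix.smul_mul, Matrix.mul_one, hA, Matrix.mul_smul,
    Matrix.smul_mul, hΩ']

include lam hlam hiso in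
/-- **`hagree` FROM THE INTEGERS under general position**: if `T_∞ ∩ T′_∞ ⊆ Z(𝔸)` (`hgen`) and
`eP w + eM w = eP′ w + eM′ w` at every infinite place (`hsum`), the two weight characters agree on `T_∞ ∩ T′_∞`. -/
theorem hagree_of_sum_of_gen (ht : q.t = 0) (hn : ¬ IsSquare (-q.n)) (ha : ∀ i, a i ≠ 0)
    (hreal : ∀ w : InfinitePlace k, w.IsReal) (hcm : ∀ w, IsCMAt q w)
    (hA : IsAnisotropic ((PlaneData.mixedRow q (a 0) (a 2)).withTransportedTorus g g' hgg' hg'g hgΩ))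
    (eP eM eP' eM' : InfinitePlace k → ℤ) (hsum : ∀ w, eP w + eM w = eP' w + eM' w)
    (hgen : ∀ t : GA ((PlaneData.mixedRow q (a 0) (a 2)).withTransportedTorus g g' hgg' hg'g hgΩ),
      t ∈ torusT ((PlaneData.mixedRow q (a 0) (a 2)).withTransportedTorus g g' hgg' hg'g hgΩ) →
      t ∈ torusT' ((PlaneData.mixedRow q (a 0) (a 2)).withTransportedTorus g g' hgg' hg'g hgΩ) →
      t ∈ infinitePart ((PlaneData.mixedRow q (a 0) (a 2)).withTransportedTorus g g' hgg' hg'g hgΩ) →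
      t ∈ centre ((PlaneData.mixedRow q (a 0) (a 2)).withTransportedTorus g g' hgg' hg'g hgΩ)) :
    ∀ t : GA ((PlaneData.mixedRow q (a 0) (a 2)).withTransportedTorus g g' hgg' hg'g hgΩ),
      t ∈ torusT ((PlaneData.mixedRow q (a 0) (a 2)).withTransportedTorus g g' hgg' hg'g hgΩ) →
      t ∈ torusT' ((PlaneData.mixedRow q (a 0) (a 2)).withTransportedTorus g g' hgg' hg'g hgΩ) →
      t ∈ infinitePart ((PlaneData.mixedRow q (a 0) (a 2)).withTransportedTorus g g' hgg' hg'g hgΩ) →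
      (∏ w : InfinitePlace k,
        (weightAt ((PlaneData.mixedRow q (a 0) (a 2)).withTransportedTorus g g' hgg' hg'g hgΩ) q w 0 t ^ (-(eP w)) *
          weightAt ((PlaneData.mixedRow q (a 0) (a 2)).withTransportedTorus g g' hgg' hg'g hgΩ) q w 1 t ^ (-(eM w)))) =
        torusWeight' q a g g' hgg' hg'g hgΩ eP' eM' t := by
  intro t hT hT' hinf
  obtain ⟨x, y, hxy⟩ := exists_scalar_of_mem_centre
    (isGenuineRow_seesawPlane q ht hn a (ha 0) (ha 2) g g' hgg' hg'g hgΩ lam hlam hiso) hA (hgen t hT hT' hinf)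
  unfold torusWeight'
  refine Finset.prod_congr rfl fun w _ => ?_
  have h0 := weightAt_eq_blockWeight_of_mat_scalar q w _ (seesaw_Omega_eq q a g g' hgg' hg'g hgΩ) t x y hxy 0
  have h1 := weightAt_eq_blockWeight_of_mat_scalar q w _ (seesaw_Omega_eq q a g g' hgg' hg'g hgΩ) t x y hxy 1
  have h0' := weightAt'_eq_blockWeight_of_mat_scalar_seesaw q a g g' hgg' hg'g hgΩ lam hiso w t x y hxy 0
  have h1' := weightAt'_eq_blockWeight_of_mat_scalar_seesaw q a g g' hgg' hg'g hgΩ lam hiso w t x y hxy 1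
  have hu : blockWeight q w x y ≠ 0 := by
    rw [← h0]
    exact weightAt_ne_zero_seesaw q a g g' hgg' hg'g hgΩ (ha 0) (ha 2) w (hreal w) (hcm w) 0 hT
  rw [h0, h1, h0', h1', ← zpow_add₀ hu, ← zpow_add₀ hu]
  congr 1
  have := hsum w
  omega

include lam hlam hiso in
/-- **THE (B) ROW FROM THE INTEGERS**: the wall's pair with all twelve character binders from `(eP, eM, eP′, eM′)`
with `eP w + eM w = eP′ w + eM′ w`, modulo the print (twice), p723452's `hcl`/`hbot` and the general position of the
two tori at infinity (`hgen`). -/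
theorem exists_wall_character_pair_seesaw_of_sum (ht : q.t = 0) (hn : ¬ IsSquare (-q.n)) (ha : ∀ i, a i ≠ 0)
    (hreal : ∀ w : InfinitePlace k, w.IsReal) (hcm : ∀ w, IsCMAt q w)
    (hA : IsAnisotropic ((PlaneData.mixedRow q (a 0) (a 2)).withTransportedTorus g g' hgg' hg'g hgΩ))
    [hcl : IsClosed ((rationalOf ((PlaneData.mixedRow q (a 0) (a 2)).withTransportedTorus g g' hgg' hg'g hgΩ)
      (torusT ((PlaneData.mixedRow q (a 0) (a 2)).withTransportedTorus g g' hgg' hg'g hgΩ)) :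
      Subgroup (torusT ((PlaneData.mixedRow q (a 0) (a 2)).withTransportedTorus g g' hgg' hg'g hgΩ))) :
      Set (torusT ((PlaneData.mixedRow q (a 0) (a 2)).withTransportedTorus g g' hgg' hg'g hgΩ)))]
    (hbot : rationalOf ((PlaneData.mixedRow q (a 0) (a 2)).withTransportedTorus g g' hgg' hg'g hgΩ)
      (torusT ((PlaneData.mixedRow q (a 0) (a 2)).withTransportedTorus g g' hgg' hg'g hgΩ)) ⊓
      torusInf ((PlaneData.mixedRow q (a 0) (a 2)).withTransportedTorus g g' hgg' hg'g hgΩ) = ⊥)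
    (hDE : letI : CommGroup (torusT ((PlaneData.mixedRow q (a 0) (a 2)).withTransportedTorus g g' hgg' hg'g hgΩ)) :=
        { (inferInstance : Group (torusT ((PlaneData.mixedRow q (a 0) (a 2)).withTransportedTorus g g' hgg' hg'g hgΩ)))
          with mul_comm := torusT_seesaw_mul_comm q a g g' hgg' hg'g hgΩ (ha 0) (ha 2) }
      haveI : CompactSpace (torusT ((PlaneData.mixedRow q (a 0) (a 2)).withTransportedTorus g g' hgg' hg'g hgΩ) ⧸
          rationalOf ((PlaneData.mixedRow q (a 0) (a 2)).withTransportedTorus g g' hgg' hg'g hgΩ)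
            (torusT ((PlaneData.mixedRow q (a 0) (a 2)).withTransportedTorus g g' hgg' hg'g hgΩ))) :=
        compactSpace_quotient_of_cocompact _ (cocompact_rationalOf_torusT_of_anisotropic _
          (isGenuineRow_seesawPlane q ht hn a (ha 0) (ha 2) g g' hgg' hg'g hgΩ lam hlam hiso) hA)
      DeitmarEchterhoff2014_Cor_3_6_2_restriction_surjective
        (torusT ((PlaneData.mixedRow q (a 0) (a 2)).withTransportedTorus g g' hgg' hg'g hgΩ) ⧸
          rationalOf ((PlaneData.mixedRow q (a 0) (a 2)).withTransportedTorus g g' hgg' hg'g hgΩ)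
            (torusT ((PlaneData.mixedRow q (a 0) (a 2)).withTransportedTorus g g' hgg' hg'g hgΩ))))
    (hDE' : letI : CommGroup (torusT' ((PlaneData.mixedRow q (a 0) (a 2)).withTransportedTorus g g' hgg' hg'g hgΩ)) :=
        { (inferInstance : Group (torusT' ((PlaneData.mixedRow q (a 0) (a 2)).withTransportedTorus g g' hgg' hg'g hgΩ)))
          with mul_comm := torusT'_seesaw_mul_comm q a g g' hgg' hg'g hgΩ lam hlam hiso (ha 1) (ha 3) }
      haveI : IsClosed ((rationalOf ((PlaneData.mixedRow q (a 0) (a 2)).withTransportedTorus g g' hgg' hg'g hgΩ)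
          (torusT' ((PlaneData.mixedRow q (a 0) (a 2)).withTransportedTorus g g' hgg' hg'g hgΩ)) :
          Subgroup (torusT' ((PlaneData.mixedRow q (a 0) (a 2)).withTransportedTorus g g' hgg' hg'g hgΩ))) :
          Set (torusT' ((PlaneData.mixedRow q (a 0) (a 2)).withTransportedTorus g g' hgg' hg'g hgΩ))) :=
        isClosed_rationalOf_torusT' _
      haveI : CompactSpace (torusT' ((PlaneData.mixedRow q (a 0) (a 2)).withTransportedTorus g g' hgg' hg'g hgΩ) ⧸
          rationalOf ((PlaneData.mixedRow q (a 0) (a 2)).withTransportedTorus g g' hgg' hg'g hgΩ)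
            (torusT' ((PlaneData.mixedRow q (a 0) (a 2)).withTransportedTorus g g' hgg' hg'g hgΩ))) :=
        compactSpace_quotient_of_cocompact _ (cocompact_rationalOf_torusT'_of_anisotropic _
          (isGenuineRow_seesawPlane q ht hn a (ha 0) (ha 2) g g' hgg' hg'g hgΩ lam hlam hiso) hA)
      DeitmarEchterhoff2014_Cor_3_6_2_restriction_surjective
        (torusT' ((PlaneData.mixedRow q (a 0) (a 2)).withTransportedTorus g g' hgg' hg'g hgΩ) ⧸
          rationalOf ((PlaneData.mixedRow q (a 0) (a 2)).withTransportedTorus g g' hgg' hg'g hgΩ)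
            (torusT' ((PlaneData.mixedRow q (a 0) (a 2)).withTransportedTorus g g' hgg' hg'g hgΩ))))
    (eP eM eP' eM' : InfinitePlace k → ℤ) (hsum : ∀ w, eP w + eM w = eP' w + eM' w)
    (hgen : ∀ t : GA ((PlaneData.mixedRow q (a 0) (a 2)).withTransportedTorus g g' hgg' hg'g hgΩ),
      t ∈ torusT ((PlaneData.mixedRow q (a 0) (a 2)).withTransportedTorus g g' hgg' hg'g hgΩ) →
      t ∈ torusT' ((PlaneData.mixedRow q (a 0) (a 2)).withTransportedTorus g g' hgg' hg'g hgΩ) →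
      t ∈ infinitePart ((PlaneData.mixedRow q (a 0) (a 2)).withTransportedTorus g g' hgg' hg'g hgΩ) →
      t ∈ centre ((PlaneData.mixedRow q (a 0) (a 2)).withTransportedTorus g g' hgg' hg'g hgΩ)) :
    ∃ chi : torusT ((PlaneData.mixedRow q (a 0) (a 2)).withTransportedTorus g g' hgg' hg'g hgΩ) → ℂ,
    ∃ chi' : torusT' ((PlaneData.mixedRow q (a 0) (a 2)).withTransportedTorus g g' hgg' hg'g hgΩ) → ℂ,
      (∀ s t, chi (s * t) = chi s * chi t) ∧
      (∀ t ∈ rationalOf ((PlaneData.mixedRow q (a 0) (a 2)).withTransportedTorus g g' hgg' hg'g hgΩ)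
        (torusT ((PlaneData.mixedRow q (a 0) (a 2)).withTransportedTorus g g' hgg' hg'g hgΩ)), chi t = 1) ∧
      Continuous chi ∧ (∀ t, ‖chi t‖ = 1) ∧
      (∀ w : InfinitePlace k, ChiMatchesAt ((PlaneData.mixedRow q (a 0) (a 2)).withTransportedTorus g g' hgg' hg'g hgΩ)
        q w (eP w) (eM w) chi) ∧
      (∀ s t, chi' (s * t) = chi' s * chi' t) ∧
      (∀ t ∈ rationalOf ((PlaneData.mixedRow q (a 0) (a 2)).withTransportedTorus g g' hgg' hg'g hgΩ)
        (torusT' ((PlaneData.mixedRow q (a 0) (a 2)).withTransportedTorus g g' hgg' hg'g hgΩ)), chi' t = 1) ∧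
      Continuous chi' ∧ (∀ t, ‖chi' t‖ = 1) ∧
      (∀ w : InfinitePlace k, ChiMatchesAt' ((PlaneData.mixedRow q (a 0) (a 2)).withTransportedTorus g g' hgg' hg'g hgΩ)
        q w g g' (eP' w) (eM' w) chi') ∧
      ∀ (z : GA ((PlaneData.mixedRow q (a 0) (a 2)).withTransportedTorus g g' hgg' hg'g hgΩ))
        (hz : z ∈ centre ((PlaneData.mixedRow q (a 0) (a 2)).withTransportedTorus g g' hgg' hg'g hgΩ)),
        chi ⟨z, centre_le_torusT _ hz⟩ = chi' ⟨z, centre_le_torusT' _ hz⟩ :=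
  exists_wall_character_pair_seesaw_of_agree q a g g' hgg' hg'g hgΩ lam hlam hiso ht hn ha hreal hcm hA hbot hDE hDE'
    eP eM eP' eM' (hagree_of_sum_of_gen q a g g' hgg' hg'g hgΩ lam hlam hiso ht hn ha hreal hcm hA eP eM eP' eM' hsum hgen)

end Seesaw

end Summit.Ventures.HodgeRepro.Tier4.Line4

end
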